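import Mathlib
import HarnessLib
import Literature.NumberTheory.GaloisRepresentations.GaloisRep
import Literature.NumberTheory.GaloisRepresentations.FramedRepTwist
import Summits.Langlands.Langlands.Theorems.EisensteinProModularSeed.Negative.OrientedFrame

/-!
# Stub `stub_restrictTwistGaloisPackage` (line `descend-raise-basechange`, crux stmt-Langlands-12920) —
# auxiliary file I: Teichmüller lifts and two frame lemmas

Helper lemmas (all proved, no new definition) for the Galois-side transport S3 of the line
`descend-raise-basechange` of `Summit.Langlands.Langlands.Theses.SkinnerWilesDefectOne.EisensteinProModularSeed`:

* `O = 𝒪_{ℚ̄_p}` (`hO : O = Valued.v.valuationSubring`): `p ∈ 𝔪`, `char κ = p`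
  (`charP_residueField`), roots of unity of order prime to `p` congruent to `1` are `1`
  (`eq_one_of_pow_eq_one_of_residue_eq_one`), finite subgroups of `κˣ` have order prime to `p`, and
  the **Teichmüller lift** of a finite subgroup `H ≤ κˣ` (`exists_teichmuller`: a homomorphism
  `T : H → Oˣ` of finite exponent reducing to the inclusion) — Serre, *Local Fields*, Ch. II §4, Prop. 8;
* finiteness of the image of a character of a compact group with open kernel
  (`finite_range_of_ker_mem_nhds`);
* entries of `scalar(c) · B` (`scalar_mul_val_apply`), conjugation of a central twist
  (`conj_twist_frame`), the integral model `χ · ρ₀` of a scalar twist (`exists_integral_twist`), and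
  the orientation inequality under an integral
  residually-Borel change of frame (`orientation_mul_of_residuallyBorel`, adapted from the disprover's
  `Cruxes/EisensteinProModularSeed/Disproof.lean` §2).

(The valuation lemmas `mem_O_iff` / `v_lt_one_of_mem_maximalIdeal`, the compatibility of the cyclotomic
character with restriction and the index of `Γ_E` in `Γ_K` are in the tree:
`SkinnerWilesDefectOneFiveIsogenyEllipticCurvesIntegralFrame`, `LocalKroneckerWeberInertiaProofs`,
`ArtinFormalismInductionProofs`.)

References: J.-P. Serre, *Local Fields* (1979), Ch. II §4 (multiplicative representatives), Ch. IV §2.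
[folklore]
-/

set_option linter.dupNamespace false -- project-wide option (lakefile weak.linter.dupNamespace); `Summit.Langlands.Langlands` is the mandated namespace

noncomputable section

namespace Summit.Langlands.Langlands.Theorems.SkinnerWilesDefectOne.EisensteinProModularSeed.RestrictTwist

open Literature.NumberTheory.GaloisRepresentations
open Summit.Langlands.Langlands.Theorems.EisensteinProModularSeed.Negative
  (mem_maximalIdeal_of_v_lt_one orientation_ne_zero)
open IsLocalRing Field
open scoped NumberField Matrix

/-! ### The valuation ring `O = 𝒪_{ℚ̄_p}` and Teichmüller lifts -/

section Teichmuller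

variable {p : ℕ} [Fact p.Prime] {O : ValuationSubring (PadicAlgCl p)}

/-- `p ∈ 𝔪_O` for `O = 𝒪_{ℚ̄_p}` (`‖p‖ = 1/p < 1`). [folklore] -/
theorem natCast_mem_maximalIdeal
    (hO : O = (Valued.v : Valuation (PadicAlgCl p) NNReal).valuationSubring) :
    (p : O) ∈ maximalIdeal O := by
  apply mem_maximalIdeal_of_v_lt_one hO
  have h : ((p : O) : PadicAlgCl p) = (p : PadicAlgCl p) := by push_cast; rfl
  rw [h, PadicAlgCl.valuation_p, one_div]
  have hp : (1 : NNReal) < p := by exact_mod_cast (Fact.out : p.Prime).one_lt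
  exact inv_lt_one_of_one_lt₀ hp

/-- The residue field `κ = O/𝔪` of `O = 𝒪_{ℚ̄_p}` has characteristic `p`. [folklore] -/
theorem charP_residueField
    (hO : O = (Valued.v : Valuation (PadicAlgCl p) NNReal).valuationSubring) :
    CharP (ResidueField O) p := by
  have h0 : (p : ResidueField O) = 0 := by
    rw [← map_natCast (residue O), residue_eq_zero_iff]
    exact natCast_mem_maximalIdeal hO
  have h := ringChar.charP (ResidueField O)
  rwa [CharP.ringChar_of_prime_eq_zero Fact.out h0] at h

/-- In `O = 𝒪_{ℚ̄_p}`: a `d`-th root of unity with `p ∤ d` which is `≡ 1 (mod 𝔪)` equals `1`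
(`(1 + u + ⋯ + u^{d-1})(u - 1) = 0` and the first factor is `≡ d`, a unit).
Serre, *Local Fields*, Ch. IV §2 (roots of unity of order prime to `p` inject into the residue field).
[folklore] -/
theorem eq_one_of_pow_eq_one_of_residue_eq_one
    (hO : O = (Valued.v : Valuation (PadicAlgCl p) NNReal).valuationSubring)
    {u : O} {d : ℕ} (hd : ¬ p ∣ d) (hu : u ^ d = 1) (h1 : residue O u = 1) : u = 1 := by
  haveI := charP_residueField hO
  have hsum : IsUnit (∑ i ∈ Finset.range d, u ^ i) := by
    by_contra hnu
    have hmem : (∑ i ∈ Finset.range d, u ^ i) ∈ maximalIdeal O := hnu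
    rw [← residue_eq_zero_iff, map_sum] at hmem
    simp only [map_pow, h1, one_pow, Finset.sum_const, Finset.card_range, nsmul_eq_mul,
      mul_one] at hmem
    exact hd ((CharP.cast_eq_zero_iff (ResidueField O) p d).mp hmem)
  have h := geom_sum_mul u d
  rw [hu, sub_self] at h
  exact sub_eq_zero.mp (hsum.mul_right_eq_zero.mp h)

/-- A finite subgroup of `κˣ`, `κ` the residue field of `𝒪_{ℚ̄_p}`, has order prime to `p`
(an element of order `p` would satisfy `(x - 1)^p = 0`). [folklore] -/
theorem not_dvd_card_subgroup_units
    (hO : O = (Valued.v : Valuation (PadicAlgCl p) NNReal).valuationSubring)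
    (H : Subgroup (ResidueField O)ˣ) [Finite H] : ¬ p ∣ Nat.card H := by
  haveI := charP_residueField hO
  intro hdvd
  obtain ⟨x, hx⟩ := exists_prime_orderOf_dvd_card' (G := H) p hdvd
  have hxp : (((x : (ResidueField O)ˣ) : ResidueField O)) ^ p = 1 := by
    have h := congrArg (fun y : H => (((y : (ResidueField O)ˣ) : ResidueField O)))
      (pow_orderOf_eq_one x)
    simpa only [hx, Subgroup.coe_pow, Units.val_pow_eq_pow_val, Subgroup.coe_one,
      Units.val_one] using h
  have hx1 : ((x : (ResidueField O)ˣ) : ResidueField O) = 1 := by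
    have h := sub_pow_char ((x : (ResidueField O)ˣ) : ResidueField O) (1 : ResidueField O) (p := p)
    rw [hxp, one_pow, sub_self] at h
    exact sub_eq_zero.mp (pow_eq_zero_iff (Fact.out : p.Prime).ne_zero |>.mp h)
  have hx1' : x = 1 := Subtype.ext (Units.ext hx1)
  rw [hx1', orderOf_one] at hx
  exact (Fact.out : p.Prime).one_lt.ne hx

/-- **Teichmüller lift of a finite subgroup of `κˣ`.** For `O = 𝒪_{ℚ̄_p}` with residue field `κ`
and a finite subgroup `H ≤ κˣ` (of order `n`, necessarily prime to `p`), there is a homomorphism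
`T : H → Oˣ` with `T(h)^n = 1` and `T(h) ≡ h (mod 𝔪)`: `H = μ_n(κ)` is cyclic, generated by the
reduction of a primitive `n`-th root of unity `ζ ∈ O` (injectivity of reduction on `μ_n`,
`eq_one_of_pow_eq_one_of_residue_eq_one`), and `T` sends it to `ζ`.
Serre, *Local Fields*, Ch. II §4, Prop. 8 (multiplicative representatives). [folklore] -/
theorem exists_teichmuller
    (hO : O = (Valued.v : Valuation (PadicAlgCl p) NNReal).valuationSubring)
    (H : Subgroup (ResidueField O)ˣ) [Finite H] :
    ∃ (T : H →* Oˣ) (n : ℕ), 0 < n ∧ (∀ h, T h ^ n = 1) ∧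
      ∀ h : H, residue O (T h : O) = ((h : (ResidueField O)ˣ) : ResidueField O) := by
  classical
  set n := Nat.card H with hn
  have hn0 : 0 < n := Nat.card_pos
  haveI : NeZero n := ⟨hn0.ne'⟩
  have hpn : ¬ p ∣ n := not_dvd_card_subgroup_units hO H
  obtain ⟨ζ, hζ⟩ := HasEnoughRootsOfUnity.exists_primitiveRoot (PadicAlgCl p) n
  have hζn : ζ ^ n = 1 := hζ.pow_eq_one
  have hζ0 : ζ ≠ 0 := hζ.ne_zero hn0.ne'
  have hvζ : Valued.v ζ = 1 := by
    have h : Valued.v ζ ^ n = 1 := by rw [← map_pow, hζn, map_one]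
    exact (pow_eq_one_iff_of_nonneg zero_le hn0.ne').mp h
  have hζO : ζ ∈ O := by rw [hO, Valuation.mem_valuationSubring_iff]; exact hvζ.le
  have hζiO : ζ⁻¹ ∈ O := by
    rw [hO, Valuation.mem_valuationSubring_iff, map_inv₀, hvζ, inv_one]
  let ζO : Oˣ := ⟨⟨ζ, hζO⟩, ⟨ζ⁻¹, hζiO⟩, Subtype.ext (mul_inv_cancel₀ hζ0),
    Subtype.ext (inv_mul_cancel₀ hζ0)⟩
  have hζOval : ((ζO : O) : PadicAlgCl p) = ζ := rfl
  -- `ζO` has order `n`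
  let f : Oˣ →* PadicAlgCl p := O.subtype.toMonoidHom.comp (Units.coeHom O)
  have hf : Function.Injective f := fun a b hab => Units.ext (Subtype.ext hab)
  have hordζO : orderOf ζO = n := by
    rw [← orderOf_injective f hf ζO]
    change orderOf ζ = n
    exact hζ.eq_orderOf.symm
  -- its reduction `ζbar` is a primitive `n`-th root of unity of `κ`
  let ζbar : (ResidueField O)ˣ := Units.map (residue O).toMonoidHom ζO
  have hprim : IsPrimitiveRoot (ζbar : ResidueField O) n := by
    rw [IsPrimitiveRoot.iff hn0]
    refine ⟨?_, fun l hl0 hln hl => ?_⟩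
    · change residue O (ζO : O) ^ n = 1
      rw [← map_pow, ← map_one (residue O)]
      congr 1
      apply Subtype.ext
      push_cast
      rw [hζOval, hζn]
    · change residue O (ζO : O) ^ l = 1 at hl
      rw [← map_pow] at hl
      have hu : ((ζO : O) ^ l) ^ n = 1 := by
        apply Subtype.ext; push_cast; rw [hζOval, ← pow_mul, mul_comm, pow_mul, hζn, one_pow]
      have h' : ζ ^ l = 1 := by
        have h := congrArg (fun x : O => (x : PadicAlgCl p))
          (eq_one_of_pow_eq_one_of_residue_eq_one hO hpn hu hl)
        simpa [hζOval] using h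
      exact hζ.pow_ne_one_of_pos_of_lt hl0.ne' hln h'
  have hordbar : orderOf ζbar = n := (IsPrimitiveRoot.coe_units_iff.mp hprim).eq_orderOf.symm
  -- `H = μ_n(κ) ∋ ζbar`, and `ζbar` generates `H`
  have hHle : H ≤ rootsOfUnity n (ResidueField O) := fun x hx => by
    rw [mem_rootsOfUnity]
    exact congrArg Subtype.val (pow_card_eq_one' (G := H) (x := ⟨x, hx⟩))
  have hHeq : H = rootsOfUnity n (ResidueField O) :=
    Subgroup.eq_of_le_of_card_ge hHle ((card_rootsOfUnity (R := ResidueField O) (k := n)).trans le_rfl)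
  have hζbarH : ζbar ∈ H := by
    rw [hHeq, mem_rootsOfUnity]
    exact Units.ext hprim.pow_eq_one
  set g : H := ⟨ζbar, hζbarH⟩ with hg
  have hordg : orderOf g = n := by
    rw [← orderOf_injective H.subtype Subtype.coe_injective g]
    exact hordbar
  have hgen : ∀ x : H, x ∈ Subgroup.zpowers g := by
    have h : Subgroup.zpowers g = ⊤ :=
      Subgroup.eq_top_of_card_eq _ (by rw [Nat.card_zpowers, hordg])
    intro x; rw [h]; exact Subgroup.mem_top x
  let T : H →* Oˣ := monoidHomOfForallMemZpowers hgen (g' := ζO) (by rw [hordζO, hordg])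
  have hTg : T g = ζO := monoidHomOfForallMemZpowers_apply_gen hgen _
  refine ⟨T, n, hn0, fun h => ?_, fun h => ?_⟩
  · rw [← map_pow, pow_card_eq_one', map_one]
  · obtain ⟨k, rfl⟩ := Subgroup.mem_zpowers_iff.mp (hgen h)
    rw [map_zpow, hTg]
    change ((Units.map (residue O).toMonoidHom (ζO ^ k) : (ResidueField O)ˣ) : ResidueField O) = _
    rw [map_zpow]
    change ((ζbar ^ k : (ResidueField O)ˣ) : ResidueField O) =
      (((g ^ k : H) : (ResidueField O)ˣ) : ResidueField O)
    rw [Subgroup.coe_zpow]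

end Teichmuller

/-! ### Two small facts on compact groups and on `GL₂` -/

section Misc

/-- A homomorphism on a compact group whose kernel is a neighbourhood of `1` (hence an open subgroup
of finite index) has finite image. [folklore] -/
theorem finite_range_of_ker_mem_nhds {G M : Type*} [Group G] [TopologicalSpace G]
    [IsTopologicalGroup G] [CompactSpace G] [Group M] (χ : G →* M)
    (hU : (χ.ker : Set G) ∈ nhds (1 : G)) : Finite χ.range := by
  have hopen : IsOpen (χ.ker : Set G) := Subgroup.isOpen_of_mem_nhds _ hU
  haveI := Subgroup.quotient_finite_of_isOpen χ.ker hopen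
  exact Finite.of_equiv _ (QuotientGroup.quotientKerEquivRange χ).toEquiv

variable {A : Type*} [CommRing A] [TopologicalSpace A] {n : ℕ}

/-- Entries of `scalar(c) · B`: `(c · B)ᵢⱼ = c Bᵢⱼ`. [folklore] -/
theorem scalar_mul_val_apply (c : Aˣ) (B : GL (Fin n) A) (i j : Fin n) :
    (FramedRep.scalar A n c * B).val i j = (c : A) * B.val i j := by
  rw [Units.val_mul, FramedRep.coe_scalar_apply, Matrix.algebraMap_eq_diagonal, Matrix.diagonal_mul]
  rfl

/-- Conjugating a central twist: `(AQ)⁻¹ (S · A L A⁻¹) (AQ) = S · Q⁻¹ L Q` for `S` commuting with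
`(AQ)⁻¹`. [folklore] -/
theorem conj_twist_frame {G : Type*} [Group G] (A Q S L : G)
    (hS : (A * Q)⁻¹ * S = S * (A * Q)⁻¹) :
    (A * Q)⁻¹ * (S * (A * L * A⁻¹)) * (A * Q) = S * (Q⁻¹ * L * Q) := by
  calc (A * Q)⁻¹ * (S * (A * L * A⁻¹)) * (A * Q)
      = ((A * Q)⁻¹ * S) * ((A * L * A⁻¹) * (A * Q)) := by group
    _ = (S * (A * Q)⁻¹) * ((A * L * A⁻¹) * (A * Q)) := by rw [hS]
    _ = S * (Q⁻¹ * L * Q) := by group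

/-- The integral model `g ↦ χ(g) · ρ₀(g)` of a scalar twist (a homomorphism because scalars are
central). [folklore] -/
theorem exists_integral_twist {G : Type*} [Group G] (ρ₀ : G →* GL (Fin n) A) (χ : G →* Aˣ) :
    ∃ r₀ : G →* GL (Fin n) A, ∀ g, r₀ g = FramedRep.scalar A n (χ g) * ρ₀ g :=
  -- adapted from `Literature.NumberTheory.GaloisRepresentations.FramedRep.twist`
  ⟨{ toFun := fun g => FramedRep.scalar A n (χ g) * ρ₀ g
     map_one' := by rw [map_one, map_one, map_one, one_mul]
     map_mul' := fun g h => by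
       rw [map_mul, map_mul, map_mul, mul_assoc, ← mul_assoc (FramedRep.scalar A n (χ h)),
         FramedRep.scalar_mul_comm (χ h) (ρ₀ g)]
       group }, fun _ => rfl⟩

end Misc

section Orientation

variable {p : ℕ} [Fact p.Prime]

/-- **The orientation inequality is preserved by integral residually-Borel frame changes**: if
`‖P₀₀‖, ‖P₀₁‖ ≤ 1`, `‖P₁₀‖ < 1`, `‖P₁₁‖ = 1` and `‖Q₀₀‖ ≤ ‖Q₁₀‖`, then `‖(PQ)₀₀‖ ≤ ‖(PQ)₁₀‖`
(indeed `‖(PQ)₁₀‖ = ‖Q₁₀‖`). [folklore] -/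
theorem orientation_mul_of_residuallyBorel (P Q : Matrix.GeneralLinearGroup (Fin 2) (PadicAlgCl p))
    (hP00 : Valued.v (P.val 0 0) ≤ 1) (hP01 : Valued.v (P.val 0 1) ≤ 1)
    (hP10 : Valued.v (P.val 1 0) < 1) (hP11 : Valued.v (P.val 1 1) = 1)
    (hQ : Valued.v (Q.val 0 0) ≤ Valued.v (Q.val 1 0)) :
    Valued.v ((P * Q).val 0 0) ≤ Valued.v ((P * Q).val 1 0) := by
  -- adapted from `Cruxes/EisensteinProModularSeed/Disproof.lean` §2 (cdisprove gen 2)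
  have hQ10 : Q.val 1 0 ≠ 0 := orientation_ne_zero Q hQ
  have hQ10pos : 0 < Valued.v (Q.val 1 0) := by
    rw [pos_iff_ne_zero]
    exact (Valuation.ne_zero_iff _).mpr hQ10
  have e10 : (P * Q).val 1 0 = P.val 1 0 * Q.val 0 0 + P.val 1 1 * Q.val 1 0 := by
    simp [Units.val_mul, Matrix.mul_apply, Fin.sum_univ_two]
  have e00 : (P * Q).val 0 0 = P.val 0 0 * Q.val 0 0 + P.val 0 1 * Q.val 1 0 := by
    simp [Units.val_mul, Matrix.mul_apply, Fin.sum_univ_two]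
  have h1 : Valued.v (P.val 1 0 * Q.val 0 0) < Valued.v (P.val 1 1 * Q.val 1 0) := by
    rw [map_mul, map_mul, hP11, one_mul]
    by_cases h0 : Valued.v (Q.val 0 0) = 0
    · rw [h0, mul_zero]; exact hQ10pos
    · exact lt_of_lt_of_le (mul_lt_of_lt_one_left (pos_iff_ne_zero.mpr h0) hP10) hQ
  have h10 : Valued.v ((P * Q).val 1 0) = Valued.v (Q.val 1 0) := by
    rw [e10, Valuation.map_add_eq_of_lt_right _ h1, map_mul, hP11, one_mul]
  have h00 : Valued.v ((P * Q).val 0 0) ≤ Valued.v (Q.val 1 0) := by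
    rw [e00]
    refine Valuation.map_add_le _ ?_ ?_
    · rw [map_mul]
      exact le_trans (mul_le_of_le_one_left zero_le hP00) hQ
    · rw [map_mul]
      exact mul_le_of_le_one_left zero_le hP01
  rw [h10]
  exact h00

end Orientation

end Summit.Langlands.Langlands.Theorems.SkinnerWilesDefectOne.EisensteinProModularSeed.RestrictTwist

namespace Summit.Langlands.Langlands.Theorems.SkinnerWilesDefectOne.EisensteinProModularSeed

/-- **Registered sub-goal of `stub_restrictTwistGaloisPackage` (auxiliary file I): the Teichmüller lift**
of a finite subgroup of `κˣ`, `κ` the residue field of `O = 𝒪_{ℚ̄_p}` (= `RestrictTwist.exists_teichmuller`,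
stated with explicit binders, fully qualified). Serre, *Local Fields*, Ch. II §4, Prop. 8. [folklore] -/
theorem stub_restrictTwistGaloisPackage_auxTeichmuller :
    ∀ (p : ℕ) [Fact p.Prime] (O : ValuationSubring (PadicAlgCl p)), O = (Valued.v : Valuation (PadicAlgCl p) NNReal).valuationSubring → ∀ (H : Subgroup (IsLocalRing.ResidueField O)ˣ) [Finite H], ∃ (T : H →* Oˣ) (n : ℕ), 0 < n ∧ (∀ h, T h ^ n = 1) ∧ ∀ h : H, IsLocalRing.residue O (T h : O) = ((h : (IsLocalRing.ResidueField O)ˣ) : IsLocalRing.ResidueField O) :=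
  fun _ _ _ hO H _ => RestrictTwist.exists_teichmuller hO H

end Summit.Langlands.Langlands.Theorems.SkinnerWilesDefectOne.EisensteinProModularSeed

end
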